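import Literature.NumberTheory.Automorphic.TotallyRealModularity
import Literature.NumberTheory.Automorphic.ThorneQInfinityModular
import HarnessLib

/-!
# Modularity of elliptic curves over abelian totally real fields
# (Yoshikawa 2019, Thm. 1.2; Thorne 2019, Thm. 1 — Hecke-polynomial rendering)

Topic `Literature/NumberTheory/Automorphic`; companion of `TotallyRealModularity.lean` (Freitas–Le Hung–Siksek
2015, Derickx–Najman–Siksek 2020, Box 2022 — the DEGREE cells) and of `ThorneQInfinityModular.lean` (Thorne 2019
in the trace-only rendering `IsModularEllipticCurve`).  This file vendors the two printed modularity theorems whose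
hypothesis is the GALOIS TYPE of the totally real base field over `ℚ` rather than its degree:

* `Yoshikawa2019_theorem1_2` — Yoshikawa, *Modularity of elliptic curves over abelian totally real fields
  unramified at 3, 5, and 7*, J. Théor. Nombres Bordeaux 30 (2018/19), Thm. 1.2: "Let `K` be a totally real number
  field which is abelian over `ℚ`. Suppose that `K` is unramified at every prime above 3, 5, and 7. Then, any
  elliptic curve over `K` is modular."  (Proof in print: Thorne's mod-`5` theorem with `√5 ∉ K`, the author's
  mod-`7` theorem for `7` unramified (Thm. 1.5), and for the residually small cases a quadratic twist semistable
  at `3` + Freitas + the Skinner–Wiles residually-reducible lifting theorem — Remark 1.3: "at present we cannot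
  remove the hypothesis that `K` is abelian".)
* `Thorne2019_thm1_weightZero` — Thorne 2019, Thm. 1 ("elliptic curves over `ℚ_∞` are modular") in the SAME
  Hecke-polynomial rendering; `Thorne2019_thm1_weightZero.toWeak` recovers the tree's trace-only rendering
  `Thorne2019_thm1` of `ThorneQInfinityModular.lean`, exactly as `FLS2015_theorem1.toWeak` does for FLS.

Rendering (as in `TotallyRealModularity.lean`, module docstring "Rendering"): "`E` is modular" — there is a Hilbert
newform `𝔣` of parallel weight `2` with `L(E,s) = L(𝔣,s)` — is rendered by the tree's predicate
`IsAutomorphicOfWeightZero E` for an integral Weierstrass model `E` over `𝓞 K` with `Δ(E) ≠ 0` (a weight-zero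
cuspidal `π` of `GL₂(𝔸_K)` with Hecke polynomial `X² - a_w(E) X + q_w` at every `w ∤ Δ(E)`), which the printed
`L`-function identity gives at every place of good reduction of the model.  "`K/ℚ` abelian" = `IsGalois ℚ K` with
commuting automorphisms; "`K` unramified at every prime above `p`" = `p ∤ disc K` (Dedekind's discriminant theorem).
Both are named facts (D-0014): users take `(h : Yoshikawa2019_theorem1_2)`.  No `sorry`, no axioms.
-/

noncomputable section

open scoped NumberField
open NumberField WeierstrassCurve

namespace Literature.NumberTheory.Automorphic

/-- **Yoshikawa (2019), Theorem 1.2: elliptic curves over abelian totally real fields unramified at 3, 5 and 7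
are modular.** "Let `K` be a totally real number field which is abelian over `ℚ`. Suppose that `K` is unramified
at every prime above 3, 5, and 7. Then, any elliptic curve over `K` is modular."  Rendered: for every totally real
number field `K` with `K/ℚ` Galois and `Gal(K/ℚ)` commutative and `3 ∤ disc K`, `5 ∤ disc K`, `7 ∤ disc K`, every
Weierstrass model `E` over `𝓞 K` with `Δ(E) ≠ 0` is automorphic of weight zero (`IsAutomorphicOfWeightZero E`,
module docstring "Rendering").  CM curves are included (as printed).  A named fact (D-0014).  It is the floor
(`T = {3,5,7}`) of the ladder line `AbelianEllipticAwayFiveSeven` on the crux `ReciprocityUpToIrreducibility` of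
Langlands (routes IrreducibilityBySelfDuality / OrdinaryPrimeTransport). [cite: Yoshikawa2019, Thm. 1.2] -/
def Yoshikawa2019_theorem1_2 : Prop :=
  ∀ (K : Type) [Field K] [NumberField K] [IsTotallyReal K], IsGalois ℚ K →
    (∀ σ τ : K ≃ₐ[ℚ] K, σ * τ = τ * σ) →
    ¬ ((3 : ℤ) ∣ NumberField.discr K) → ¬ ((5 : ℤ) ∣ NumberField.discr K) →
    ¬ ((7 : ℤ) ∣ NumberField.discr K) →
    ∀ E : WeierstrassCurve (𝓞 K), E.Δ ≠ 0 → IsAutomorphicOfWeightZero E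

/-- **Yoshikawa 2019, Thm. 1.2 ⇒ Hilbert modularity in the cofinite sense** (`IsHilbertModular`, via
`IsHilbertModular.of_isAutomorphicOfWeightZero`). [cite: Yoshikawa2019, Thm. 1.2] -/
theorem Yoshikawa2019_theorem1_2.isHilbertModular (h : Yoshikawa2019_theorem1_2) (K : Type) [Field K]
    [NumberField K] [IsTotallyReal K] (hG : IsGalois ℚ K) (hab : ∀ σ τ : K ≃ₐ[ℚ] K, σ * τ = τ * σ)
    (h3 : ¬ ((3 : ℤ) ∣ NumberField.discr K)) (h5 : ¬ ((5 : ℤ) ∣ NumberField.discr K))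
    (h7 : ¬ ((7 : ℤ) ∣ NumberField.discr K)) (E : WeierstrassCurve (𝓞 K)) (hE : E.Δ ≠ 0) :
    IsHilbertModular E :=
  IsHilbertModular.of_isAutomorphicOfWeightZero hE (h K hG hab h3 h5 h7 E hE)

/-- **Yoshikawa 2019, Thm. 1.2 ⇒ modularity in the trace-only sense of Caraiani–Newton**
(`IsModularEllipticCurve`, via `IsHilbertModular.isModularEllipticCurve`). [cite: Yoshikawa2019, Thm. 1.2] -/
theorem Yoshikawa2019_theorem1_2.isModularEllipticCurve (h : Yoshikawa2019_theorem1_2) (K : Type) [Field K]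
    [NumberField K] [IsTotallyReal K] (hG : IsGalois ℚ K) (hab : ∀ σ τ : K ≃ₐ[ℚ] K, σ * τ = τ * σ)
    (h3 : ¬ ((3 : ℤ) ∣ NumberField.discr K)) (h5 : ¬ ((5 : ℤ) ∣ NumberField.discr K))
    (h7 : ¬ ((7 : ℤ) ∣ NumberField.discr K)) (E : WeierstrassCurve (𝓞 K)) (hE : E.Δ ≠ 0) :
    IsModularEllipticCurve K E :=
  (h.isHilbertModular K hG hab h3 h5 h7 E hE).isModularEllipticCurve

/-- **Thorne (2019), Theorem 1: elliptic curves over `ℚ_∞` are modular — Hecke-polynomial rendering.** For every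
prime `p` and every number field `K` contained in the cyclotomic `ℤ_p`-extension of `ℚ`
(`Thorne2019.IsInCyclotomicZpExtension p K`: totally real, embeds in some `ℚ(ζ_{p^{m+1}})`, degree a power of `p`),
every Weierstrass model `E` over `𝓞 K` with `Δ(E) ≠ 0` is automorphic of weight zero (`IsAutomorphicOfWeightZero E`).
The same printed theorem as the tree's `Thorne2019_thm1` (trace-only rendering `IsModularEllipticCurve`), rendered in
the stronger tree predicate exactly as `FLS2015_theorem1` renders FLS Thm. 1; see `Thorne2019_thm1_weightZero.toWeak`.
A named fact (D-0014). [cite: Thorne2019, Thm. 1] -/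
def Thorne2019_thm1_weightZero : Prop :=
  ∀ (p : ℕ), p.Prime → ∀ (K : Type) [Field K] [NumberField K],
    Thorne2019.IsInCyclotomicZpExtension p K →
      ∀ E : WeierstrassCurve (𝓞 K), E.Δ ≠ 0 → IsAutomorphicOfWeightZero E

/-- The Hecke-polynomial rendering implies the tree's trace-only rendering `Thorne2019_thm1` (via
`IsHilbertModular.of_isAutomorphicOfWeightZero` and `IsHilbertModular.isModularEllipticCurve`).
[cite: Thorne2019, Thm. 1] -/
theorem Thorne2019_thm1_weightZero.toWeak (h : Thorne2019_thm1_weightZero) : Thorne2019_thm1 :=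
  fun p hp K _ _ hK E hE =>
    (IsHilbertModular.of_isAutomorphicOfWeightZero hE (h p hp K hK E hE)).isModularEllipticCurve

end Literature.NumberTheory.Automorphic

end
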